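import Summits.NavierStokesRegularity.NavierStokesRegularity.Theorems.OddMorawetzLocal.Negative.OddMorawetzLocalRefutationData5
import Summits.NavierStokesRegularity.NavierStokesRegularity.Theorems.OddMorawetzLocal.Negative.OddMorawetzLocalRefutationDefsV
import HarnessLib

/-!
# Crux `OddMorawetzLocal` (stmt-NavierStokesRegularity-1376) — kernel certificates, weight 5 (part A2a)

The finite computations of the weight-5 half of the refutation, each a closed Boolean evaluated by the kernel
(`decide +kernel`) on the vocabulary of `OddMorawetzLocalJetAlgebra` / `…RefutationDefs{,Fast,IV,V}` and the literal
data of `…RefutationData5` (197 orbit representatives `reps5`, 50 isotropic descriptors `isoDesc5`, three certificate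
blocks `blocks5` of sizes 53/45/49, the independence columns `kcols5` and inverse `cinv5`, prime 8191).
Part A2: `cert5_e1_*` — the orbit-sum identities `e1Check 5 reps5 lo n` (step E1: a `B₃`-fixed coefficient vector lies in
the span of the 197 normalised orbit sums) for the basis monomials of the listed ranges, in chunks of 100 (kernel memory).
No analysis; lands `--supports` the crux item; consumed by the weight-5 assembly of the refutation.
-/

set_option linter.dupNamespace false

namespace Summit.NavierStokesRegularity.NavierStokesRegularity.Theorems.OddMorawetz

/-- Orbit-sum identities for the weight-5 basis monomials `1600 … 1699`. -/
theorem cert5_e1_16 : e1Check 5 reps5 1600 100 = true := by decide +kernel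

/-- Orbit-sum identities for the weight-5 basis monomials `1700 … 1799`. -/
theorem cert5_e1_17 : e1Check 5 reps5 1700 100 = true := by decide +kernel

/-- Orbit-sum identities for the weight-5 basis monomials `1800 … 1899`. -/
theorem cert5_e1_18 : e1Check 5 reps5 1800 100 = true := by decide +kernel

/-- Orbit-sum identities for the weight-5 basis monomials `1900 … 1999`. -/
theorem cert5_e1_19 : e1Check 5 reps5 1900 100 = true := by decide +kernel

/-- Orbit-sum identities for the weight-5 basis monomials `2000 … 2099`. -/
theorem cert5_e1_20 : e1Check 5 reps5 2000 100 = true := by decide +kernel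

/-- Orbit-sum identities for the weight-5 basis monomials `2100 … 2199`. -/
theorem cert5_e1_21 : e1Check 5 reps5 2100 100 = true := by decide +kernel

/-- Orbit-sum identities for the weight-5 basis monomials `2200 … 2299`. -/
theorem cert5_e1_22 : e1Check 5 reps5 2200 100 = true := by decide +kernel

/-- Orbit-sum identities for the weight-5 basis monomials `2300 … 2399`. -/
theorem cert5_e1_23 : e1Check 5 reps5 2300 100 = true := by decide +kernel

end Summit.NavierStokesRegularity.NavierStokesRegularity.Theorems.OddMorawetz
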